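import Summits.CriticalPhenomena.PercolationContinuityZ3.Theorems.SahiMasterFamilyPointwiseTensor
import Summits.CriticalPhenomena.PercolationContinuityZ3.Theorems.PercNearOneGluingNoHeavyLowerTailSahiCombTensorisation

/-!
# The settled class is closed under independent intersection — EVERY ORDER

Unit `prim-master-conj` (crux anchor stmt-CriticalPhenomena-4575, helper work), gen 14; memo
`run/shared/lean/prim/prim-l12/prim-master-conj/POINTWISE.md` §15.  Companion of `…PointwiseTensor` (order three, closed form).

For a separable family `U_i = V_i ∩ W_i` (`V_i` determined by `F`, `W_i` by `Fᶜ`) seat P3's law of total cumulance with all signs plus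
(`SahiCombTensor.sahiE_ind_separable_eq`) reads
  `E_{n+1}(μ_p; 1_U) = Σ_π [Π_{B∈π} E_{|B|}(μ_p; 1_{V_B})] · E_{|π|}(μ_p; (1_{⋂_{i∈B} W_i})_{B∈π})`.
Call a `k`-family SETTLED if at every interior parameter `E_k ≥ 0` and `E_k = 0 ↔ Z_k`.  If every sub-family `V_B` of `V` and every block-intersection
family `(⋂_{i∈B} W_i)_{B∈π}` of `W` is settled, then every summand is a product of non-negative factors each of whose vanishing at ONE interior point is the
measure-free condition "`∈ Z`", hence vanishing at every interior point: a zero of `E_{n+1}(μ_p;1_U)` transfers to the whole open cube and (EQI) gives `Z_{n+1}`.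
* `Pointwise.Settled k U` is NOT introduced as a definition; the hypotheses are spelled out (`∀ r interior, 0 ≤ E ∧ (E = 0 ↔ Z)`);
* **`sahiE_ind_tensor_nonneg_all`** — `C` tensorises (positivity at `p` from positivity of the factors at `p`; cf. P4's `sahiE_prod_tensor_nonneg`, here for events);
* **`sahiE_ind_tensor_eq_zero_transfer_all`**, **`sahiE_ind_tensor_eq_zero_iff_all`**, `sahiE_ind_tensor_pos_all` — the settled class is closed under `⊗` at
  every order `n+1`, with LOCAL hypotheses (sub-families of `V`, block-intersection families of `W`).
At order three the hypotheses reduce to "`V` and `W` settled" (`…PointwiseTensor`), sub-families of size `≤ 2` being settled unconditionally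
(`settled_of_le_two`).  HONEST FRAMING: a closure property; nothing is asserted about `C_k` / `MasterFamilyEqIff k` in general.  Axioms standard. [this work]
-/

noncomputable section

open scoped Classical

namespace Summit.CriticalPhenomena.PercolationContinuityZ3.Theorems

open Finset Function
open Literature.Combinatorics.Sahi2008
open Literature.Combinatorics.Sahi2008.PartitionForm
open Literature.Probability.Percolation (DeterminedBy)
open Literature.Probability.Percolation.DecisionTree (ind)
open SahiCombTensor

namespace Pointwise

variable {ι : Type} [Fintype ι]

/-- Families of at most two increasing events are settled unconditionally (Harris; strict Harris). [this work] -/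
theorem settled_of_le_two {k : ℕ} (hk : k ≤ 2) (U : Fin k → Set (Set ι)) (hU : ∀ j, IsUpperSet (U j)) (r : ι → unitInterval)
    (hr : ∀ e, (r e : ℝ) ∈ Set.Ioo (0 : ℝ) 1) :
    0 ≤ sahiE (bernoulliWeight r) k (fun j => ind (U j)) ∧ (sahiE (bernoulliWeight r) k (fun j => ind (U j)) = 0 ↔ SuppZeroFlag k U) :=
  ⟨masterFamilyNonneg_of_le_two hk ι r U hU, masterFamilyEqIff_of_le_two hk ι r hr U hU⟩

section All

variable {n : ℕ} (F : Finset ι) {V W : Fin (n + 1) → Set (Set ι)}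

/-- **`C_{n+1}` tensorises (events)**: positivity at `p` of every sub-family functional of `V` and of every block-intersection functional of `W` gives
`E_{n+1}(μ_p; 1_{V∩W}) ≥ 0`. [this work] -/
theorem sahiE_ind_tensor_nonneg_all (p : ι → unitInterval) (hV : ∀ i, DeterminedBy (V i) (↑F : Set ι))
    (hW : ∀ i, DeterminedBy (W i) (↑F : Set ι)ᶜ)
    (HV : ∀ B : Finset (Fin (n + 1)), 0 ≤ sahiE (bernoulliWeight p) B.card (fun j => ind (V (B.orderEmbOfFin rfl j))))
    (HW : ∀ c : OrderedFinpartition (n + 1),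
      0 ≤ sahiE (bernoulliWeight p) c.length (fun m => ind (⋂ j : Fin (block c m).card, W ((block c m).orderEmbOfFin rfl j)))) :
    0 ≤ sahiE (bernoulliWeight p) (n + 1) (fun i => ind (V i ∩ W i)) := by
  rw [sahiE_ind_separable_eq p F V W hV hW]
  exact Finset.sum_nonneg fun c _ => mul_nonneg (Finset.prod_nonneg fun m _ => HV _) (HW c)

/-- **Zero transfer for separable families, every order**: if every sub-family of `V` and every block-intersection family of `W` is settled on the open
cube, a zero of `E_{n+1}(μ_p; 1_{V∩W})` at one interior `p` forces a zero at every `q`. [this work] -/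
theorem sahiE_ind_tensor_eq_zero_transfer_all {p : ι → unitInterval} (hp : ∀ e, (p e : ℝ) ∈ Set.Ioo (0 : ℝ) 1) (q : ι → unitInterval)
    (hV : ∀ i, DeterminedBy (V i) (↑F : Set ι)) (hW : ∀ i, DeterminedBy (W i) (↑F : Set ι)ᶜ)
    (HV : ∀ (B : Finset (Fin (n + 1))) (r : ι → unitInterval), (∀ e, (r e : ℝ) ∈ Set.Ioo (0 : ℝ) 1) →
      0 ≤ sahiE (bernoulliWeight r) B.card (fun j => ind (V (B.orderEmbOfFin rfl j))) ∧
        (sahiE (bernoulliWeight r) B.card (fun j => ind (V (B.orderEmbOfFin rfl j))) = 0 ↔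
          SuppZeroFlag B.card (fun j => V (B.orderEmbOfFin rfl j))))
    (HW : ∀ (c : OrderedFinpartition (n + 1)) (r : ι → unitInterval), (∀ e, (r e : ℝ) ∈ Set.Ioo (0 : ℝ) 1) →
      0 ≤ sahiE (bernoulliWeight r) c.length (fun m => ind (⋂ j : Fin (block c m).card, W ((block c m).orderEmbOfFin rfl j))) ∧
        (sahiE (bernoulliWeight r) c.length (fun m => ind (⋂ j : Fin (block c m).card, W ((block c m).orderEmbOfFin rfl j))) = 0 ↔
          SuppZeroFlag c.length (fun m => ⋂ j : Fin (block c m).card, W ((block c m).orderEmbOfFin rfl j))))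
    (hz : sahiE (bernoulliWeight p) (n + 1) (fun i => ind (V i ∩ W i)) = 0) :
    sahiE (bernoulliWeight q) (n + 1) (fun i => ind (V i ∩ W i)) = 0 := by
  rw [sahiE_ind_separable_eq p F V W hV hW] at hz
  rw [sahiE_ind_separable_eq q F V W hV hW]
  have hnn : ∀ c ∈ (univ : Finset (OrderedFinpartition (n + 1))),
      0 ≤ (∏ m : Fin c.length, sahiE (bernoulliWeight p) (block c m).card (fun j => ind (V ((block c m).orderEmbOfFin rfl j)))) *
        sahiE (bernoulliWeight p) c.length (fun m => ind (⋂ j : Fin (block c m).card, W ((block c m).orderEmbOfFin rfl j))) :=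
    fun c _ => mul_nonneg (Finset.prod_nonneg fun m _ => (HV _ p hp).1) (HW c p hp).1
  have hterm := (Finset.sum_eq_zero_iff_of_nonneg hnn).1 hz
  refine Finset.sum_eq_zero fun c hc => ?_
  have h0 := hterm c hc
  rcases mul_eq_zero.1 h0 with h | h
  · -- some `V`-block functional vanishes at `p`, hence its family is in `Z`, hence it vanishes at `q`
    obtain ⟨m, -, hm⟩ := Finset.prod_eq_zero_iff.1 h
    have hZ := ((HV (block c m) p hp).2).1 hm
    rw [Finset.prod_eq_zero (Finset.mem_univ m) (masterFamilyEqIff_mpr _ ι q _ hZ), zero_mul]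
  · have hZ := ((HW c p hp).2).1 h
    rw [masterFamilyEqIff_mpr _ ι q _ hZ, mul_zero]

/-- **The settled class is closed under independent intersection, every order**: with the local hypotheses above, `U_i = V_i ∩ W_i` is settled:
for `p` in the open cube, `E_{n+1}(μ_p; 1_U) ≥ 0` and `E_{n+1}(μ_p; 1_U) = 0 ↔ U ∈ Z_{n+1}`. [this work] -/
theorem sahiE_ind_tensor_eq_zero_iff_all {p : ι → unitInterval} (hp : ∀ e, (p e : ℝ) ∈ Set.Ioo (0 : ℝ) 1)
    (hV : ∀ i, DeterminedBy (V i) (↑F : Set ι)) (hW : ∀ i, DeterminedBy (W i) (↑F : Set ι)ᶜ)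
    (hVu : ∀ i, IsUpperSet (V i)) (hWu : ∀ i, IsUpperSet (W i))
    (HV : ∀ (B : Finset (Fin (n + 1))) (r : ι → unitInterval), (∀ e, (r e : ℝ) ∈ Set.Ioo (0 : ℝ) 1) →
      0 ≤ sahiE (bernoulliWeight r) B.card (fun j => ind (V (B.orderEmbOfFin rfl j))) ∧
        (sahiE (bernoulliWeight r) B.card (fun j => ind (V (B.orderEmbOfFin rfl j))) = 0 ↔
          SuppZeroFlag B.card (fun j => V (B.orderEmbOfFin rfl j))))
    (HW : ∀ (c : OrderedFinpartition (n + 1)) (r : ι → unitInterval), (∀ e, (r e : ℝ) ∈ Set.Ioo (0 : ℝ) 1) →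
      0 ≤ sahiE (bernoulliWeight r) c.length (fun m => ind (⋂ j : Fin (block c m).card, W ((block c m).orderEmbOfFin rfl j))) ∧
        (sahiE (bernoulliWeight r) c.length (fun m => ind (⋂ j : Fin (block c m).card, W ((block c m).orderEmbOfFin rfl j))) = 0 ↔
          SuppZeroFlag c.length (fun m => ⋂ j : Fin (block c m).card, W ((block c m).orderEmbOfFin rfl j)))) :
    0 ≤ sahiE (bernoulliWeight p) (n + 1) (fun i => ind (V i ∩ W i)) ∧
      (sahiE (bernoulliWeight p) (n + 1) (fun i => ind (V i ∩ W i)) = 0 ↔ SuppZeroFlag (n + 1) (fun i => V i ∩ W i)) := by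
  refine ⟨sahiE_ind_tensor_nonneg_all F p hV hW (fun B => (HV B p hp).1) (fun c => (HW c p hp).1), fun hz => ?_,
    fun hZ => masterFamilyEqIff_mpr _ ι p _ hZ⟩
  refine suppZeroFlag_of_eq_zero_on_paramBox (fun i => V i ∩ W i) (fun i => (hVu i).inter (hWu i)) (a := fun _ => 0) (b := fun _ => 1)
    (fun _ => zero_lt_one) (fun _ => le_rfl) (fun _ => le_rfl) fun q _ => ?_
  exact sahiE_ind_tensor_eq_zero_transfer_all F hp q hV hW HV HW hz

/-- **Strict form, every order**: under the same hypotheses, `(V_i ∩ W_i) ∉ Z_{n+1}` has `E_{n+1}(μ_p; 1_{V∩W}) > 0` at every interior `p`. [this work] -/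
theorem sahiE_ind_tensor_pos_all {p : ι → unitInterval} (hp : ∀ e, (p e : ℝ) ∈ Set.Ioo (0 : ℝ) 1)
    (hV : ∀ i, DeterminedBy (V i) (↑F : Set ι)) (hW : ∀ i, DeterminedBy (W i) (↑F : Set ι)ᶜ)
    (hVu : ∀ i, IsUpperSet (V i)) (hWu : ∀ i, IsUpperSet (W i))
    (HV : ∀ (B : Finset (Fin (n + 1))) (r : ι → unitInterval), (∀ e, (r e : ℝ) ∈ Set.Ioo (0 : ℝ) 1) →
      0 ≤ sahiE (bernoulliWeight r) B.card (fun j => ind (V (B.orderEmbOfFin rfl j))) ∧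
        (sahiE (bernoulliWeight r) B.card (fun j => ind (V (B.orderEmbOfFin rfl j))) = 0 ↔
          SuppZeroFlag B.card (fun j => V (B.orderEmbOfFin rfl j))))
    (HW : ∀ (c : OrderedFinpartition (n + 1)) (r : ι → unitInterval), (∀ e, (r e : ℝ) ∈ Set.Ioo (0 : ℝ) 1) →
      0 ≤ sahiE (bernoulliWeight r) c.length (fun m => ind (⋂ j : Fin (block c m).card, W ((block c m).orderEmbOfFin rfl j))) ∧
        (sahiE (bernoulliWeight r) c.length (fun m => ind (⋂ j : Fin (block c m).card, W ((block c m).orderEmbOfFin rfl j))) = 0 ↔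
          SuppZeroFlag c.length (fun m => ⋂ j : Fin (block c m).card, W ((block c m).orderEmbOfFin rfl j))))
    (hZ : ¬ SuppZeroFlag (n + 1) (fun i => V i ∩ W i)) : 0 < sahiE (bernoulliWeight p) (n + 1) (fun i => ind (V i ∩ W i)) := by
  obtain ⟨h0, hiff⟩ := sahiE_ind_tensor_eq_zero_iff_all F hp hV hW hVu hWu HV HW
  exact lt_of_le_of_ne h0 fun h => hZ (hiff.1 h.symm)

end All

end Pointwise

end Summit.CriticalPhenomena.PercolationContinuityZ3.Theorems
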